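import Mathlib

/-!
# One algebraic Weil class suffices — the algebraic core

Abstract form of Lemma 2.3 of `proofs/P2-WeilDiscriminantReduction.md` (also p4 Thm B, P5 Lemma 4.4):
if a ℚ-subspace `S` of a `K`-vector space `W` (K a field of characteristic 0) is stable under
`x ^ N • _` for every `x : K`, then it is stable under `x • _` for every `x : K`, i.e. it is a
`K`-subspace; if `W` is one-dimensional over `K`, then `S = ⊥` or `S = ⊤`.

The key input is that `x` lies in the ℚ-span of the shifted powers `(x + k) ^ N`, `k = 0, …, N`,
proved by finite differences (`fwdDiff`).
-/

open Finset fwdDiff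

namespace HodgeRepro0.OneClass

variable {R : Type*} [CommRing R]

/-- `Δ^[m] (r ↦ r^(m+1))` is an affine function `r ↦ (m+1)! • r + c` for some constant `c : ℕ`. -/
theorem fwdDiff_iter_pow_succ (m : ℕ) :
    ∃ c : ℕ, (fwdDiff (1:R))^[m] (fun r : R ↦ r ^ (m + 1)) = fun r ↦ ((m + 1).factorial : R) * r + (c : R) := by
  induction m with
  | zero =>
    refine ⟨0, ?_⟩
    ext r
    simp
  | succ m ih =>
    obtain ⟨c, hc⟩ := ih
    -- expand one forward difference of r^(m+2)
    have hexp : (fwdDiff (1:R) fun r : R ↦ r ^ (m + 2)) =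
        ∑ i ∈ range (m + 2), (m + 2).choose i • fun r : R ↦ r ^ i := by
      ext x
      simp [nsmul_eq_mul, fwdDiff, add_pow, sum_range_succ, mul_comm]
    rw [Function.iterate_succ_apply, hexp, fwdDiff_iter_finsetSum]
    simp_rw [fwdDiff_iter_const_smul]
    rw [sum_range_succ, sum_range_succ]
    have hzero : ∀ i ∈ range m, (m + 2).choose i • (fwdDiff (1:R))^[m] (fun r : R ↦ r ^ i) = 0 := by
      intro i hi
      rw [fwdDiff_iter_pow_eq_zero_of_lt (mem_range.1 hi), smul_zero]
    rw [sum_eq_zero hzero, zero_add]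
    refine ⟨(m + 2).choose m * m.factorial + (m + 2) * c, ?_⟩
    have h1 : (fwdDiff (1:R))^[m] (fun r : R ↦ r ^ m) = fun _ ↦ ((m.factorial : ℕ) : R) := by
      have := (fwdDiff_iter_eq_factorial (R := R) (n := m))
      rw [this]; rfl
    rw [h1, hc]
    ext r
    simp only [Pi.add_apply, Pi.smul_apply]
    simp only [nsmul_eq_mul, Nat.choose_succ_self_right]
    push_cast
    rw [Nat.factorial_succ (m + 1)]
    push_cast
    ring

variable [Algebra ℚ R]

/-- The iterated forward differences of `r ↦ r ^ N` at `f` lie in the ℚ-span of the shifted powers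
`(f + k) ^ N`, `k = 0, …, N` (for `n ≤ N` differences). -/
theorem fwdDiff_iter_pow_mem_span (f : R) (N n : ℕ) (hn : n ≤ N) :
    (fwdDiff (1:R))^[n] (fun r : R ↦ r ^ N) f ∈
      Submodule.span ℚ (Set.range fun k : Fin (N + 1) ↦ (f + (k : ℕ)) ^ N) := by
  rw [fwdDiff_iter_eq_sum_shift]
  refine Submodule.sum_mem _ fun k hk ↦ ?_
  rw [← Int.cast_smul_eq_zsmul ℚ]
  refine Submodule.smul_mem _ _ (Submodule.subset_span ?_)
  refine ⟨⟨k, by have := mem_range.1 hk; omega⟩, ?_⟩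
  simp

/-- **Key lemma.** In a commutative ℚ-algebra, `f` lies in the ℚ-span of `(f + k) ^ N`, `k = 0, …, N`,
for every `N ≥ 1`. -/
theorem mem_span_shifted_pow (f : R) (N : ℕ) (hN : 1 ≤ N) :
    f ∈ Submodule.span ℚ (Set.range fun k : Fin (N + 1) ↦ (f + (k : ℕ)) ^ N) := by
  set S := Submodule.span ℚ (Set.range fun k : Fin (N + 1) ↦ (f + (k : ℕ)) ^ N) with hS
  obtain ⟨m, rfl⟩ : ∃ m, N = m + 1 := ⟨N - 1, by omega⟩
  -- the (m+1)-st difference is the constant (m+1)!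
  have hfact : ((m + 1).factorial : R) ∈ S := by
    have h := fwdDiff_iter_pow_mem_span f (m + 1) (m + 1) le_rfl
    rwa [fwdDiff_iter_eq_factorial] at h
  have hfact_ne : ((m + 1).factorial : ℚ) ≠ 0 := by exact_mod_cast (Nat.factorial_pos _).ne'
  have hcast : ((m + 1).factorial : R) = ((m + 1).factorial : ℚ) • (1 : R) := by
    rw [Algebra.smul_def, mul_one, map_natCast]
  have hone : (1 : R) ∈ S := by
    have := S.smul_mem (((m + 1).factorial : ℚ)⁻¹) hfact
    rwa [hcast, smul_smul, inv_mul_cancel₀ hfact_ne, one_smul] at this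
  -- the m-th difference is affine: (m+1)! * f + c
  obtain ⟨c, hc⟩ := fwdDiff_iter_pow_succ (R := R) m
  have haff : ((m + 1).factorial : R) * f + (c : R) ∈ S := by
    have h := fwdDiff_iter_pow_mem_span f (m + 1) m (Nat.le_succ m)
    rwa [hc] at h
  have hc' : (c : R) ∈ S := by
    have : (c : R) = (c : ℚ) • (1 : R) := by rw [Algebra.smul_def, mul_one, map_natCast]
    rw [this]; exact S.smul_mem _ hone
  have hmul : ((m + 1).factorial : R) * f ∈ S := by
    have := S.sub_mem haff hc'
    simpa using this
  have : f = ((m + 1).factorial : ℚ)⁻¹ • (((m + 1).factorial : R) * f) := by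
    have h2 : ((m + 1).factorial : R) * f = ((m + 1).factorial : ℚ) • f := by
      rw [Algebra.smul_def, map_natCast]
    rw [h2, smul_smul, inv_mul_cancel₀ hfact_ne, one_smul]
  rw [this]
  exact S.smul_mem _ hmul


section Kstable

variable {K W : Type*} [Field K] [Algebra ℚ K] [AddCommGroup W] [Module K W] [Module ℚ W]
  [IsScalarTower ℚ K W]

/-- A ℚ-subspace `S` of a `K`-vector space which is stable under `x ^ N • _` for every `x : K`
(`N ≥ 1`) is stable under `x • _` for every `x : K`. -/
theorem smul_mem_of_pow_smul_mem (S : Submodule ℚ W) (N : ℕ) (hN : 1 ≤ N)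
    (hS : ∀ x : K, ∀ w ∈ S, x ^ N • w ∈ S) (x : K) {w : W} (hw : w ∈ S) : x • w ∈ S := by
  let φ : K →ₗ[ℚ] W :=
    { toFun := fun y ↦ y • w
      map_add' := fun a b ↦ add_smul a b w
      map_smul' := fun q a ↦ by simp [smul_assoc] }
  have hx : φ x ∈ (Submodule.span ℚ (Set.range fun k : Fin (N + 1) ↦ (x + (k : ℕ)) ^ N)).map φ :=
    Submodule.mem_map_of_mem (mem_span_shifted_pow x N hN)
  rw [Submodule.map_span] at hx
  refine (Submodule.span_le.mpr ?_) hx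
  rintro _ ⟨_, ⟨k, rfl⟩, rfl⟩
  exact hS _ w hw

/-- **One class suffices.** If `W` is one-dimensional over `K` and the ℚ-subspace `S` is stable
under all `x ^ N • _`, then `S = ⊥` or `S = ⊤`: one non-zero element of `S` forces `S = W`. -/
theorem eq_bot_or_eq_top (S : Submodule ℚ W) (N : ℕ) (hN : 1 ≤ N)
    (hS : ∀ x : K, ∀ w ∈ S, x ^ N • w ∈ S) (h1 : Module.finrank K W = 1) :
    S = ⊥ ∨ S = ⊤ := by
  by_cases hbot : S = ⊥
  · exact Or.inl hbot
  · right
    obtain ⟨w, hw, hw0⟩ := (Submodule.ne_bot_iff S).mp hbot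
    rw [Submodule.eq_top_iff']
    intro v
    obtain ⟨c, rfl⟩ := (finrank_eq_one_iff_of_nonzero' w hw0).mp h1 v
    exact smul_mem_of_pow_smul_mem S N hN hS c hw

/-- Variant: a non-zero element of `S` and the `x ^ N`-stability give `S = ⊤`. -/
theorem eq_top_of_exists_ne_zero (S : Submodule ℚ W) (N : ℕ) (hN : 1 ≤ N)
    (hS : ∀ x : K, ∀ w ∈ S, x ^ N • w ∈ S) (h1 : Module.finrank K W = 1)
    (hne : ∃ w ∈ S, w ≠ 0) : S = ⊤ := by
  rcases eq_bot_or_eq_top S N hN hS h1 with h | h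
  · obtain ⟨w, hw, hw0⟩ := hne
    exact absurd (by simpa [h] using hw) hw0
  · exact h

end Kstable


section order

variable {K W : Type*} [Field K] [Algebra ℚ K] [AddCommGroup W] [Module K W] [Module ℚ W]
  [IsScalarTower ℚ K W]

/-- It suffices to have the `x ^ N`-stability for `x` in a subset `T ⊆ K` every element of `K` is a
rational multiple of (e.g. an order `𝒪 ⊆ K`, `K = ℚ·𝒪`): the stability extends to all of `K`. -/
theorem pow_smul_mem_of_subset (S : Submodule ℚ W) (N : ℕ) (T : Set K)
    (hT : ∀ y : K, ∃ q : ℚ, ∃ o ∈ T, y = q • o)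
    (hS : ∀ x ∈ T, ∀ w ∈ S, x ^ N • w ∈ S) (x : K) {w : W} (hw : w ∈ S) : x ^ N • w ∈ S := by
  obtain ⟨q, o, ho, rfl⟩ := hT x
  rw [smul_pow, smul_assoc]
  exact S.smul_mem _ (hS o ho w hw)

/-- **One class suffices (order form).** `W` one-dimensional over `K`, `T ⊆ K` with `K = ℚ·T`,
`S ⊆ W` a ℚ-subspace stable under `x ^ N • _` for `x ∈ T` (`N ≥ 1`): a non-zero element of `S`
forces `S = ⊤`. In the application `W = W_K(A)`, `S = Alg(A) ∩ W_K(A)`, `T = 𝒪 ∩ End(A)`,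
`N = 2n`, and `x ^ N • _` is the action of the algebraic correspondence `f^*`, `f = x`. -/
theorem eq_top_of_exists_ne_zero_of_subset (S : Submodule ℚ W) (N : ℕ) (hN : 1 ≤ N) (T : Set K)
    (hT : ∀ y : K, ∃ q : ℚ, ∃ o ∈ T, y = q • o)
    (hS : ∀ x ∈ T, ∀ w ∈ S, x ^ N • w ∈ S) (h1 : Module.finrank K W = 1)
    (hne : ∃ w ∈ S, w ≠ 0) : S = ⊤ :=
  eq_top_of_exists_ne_zero S N hN (fun x _ hw ↦ pow_smul_mem_of_subset S N T hT hS x hw) h1 hne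

end order

end HodgeRepro0.OneClass
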